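import Summits.ValiantsHypothesis.ValiantsHypothesis.Theorems.VPBoundarySquarePresentableSplit
import Literature.Computability.AlgebraicComplexity.BDS24ExponentialInterpolation
import Literature.Computability.AlgebraicComplexity.Bur24UnboundedDegreeTransfer
import HarnessLib

/-!
# VPBoundarySquare — the GRH transfer: `VP = VNP` de-borders the presentable closure of VP
(decomp-valiant lens 3, NODE v7 «NB-TRANSFER»)

Two inputs, one theorem, one 2024 named fact:

* (A, THEOREM, `Literature/…/BDS24ExponentialInterpolation.lean`) Bhargav–Dwivedi–Saxena 2024
  Lemma 4.1 in characteristic zero: `\overline{VP}_ε ∩ {p-families} ⊆ VNPnb^ℂ`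
  (`IsPresVPBarFamily.isVNPnbFamily`: the coefficient of `ε^M` of a presentation is a Boolean sum
  over `{0,1}^t` of ONE p-size circuit of exponential degree — Fourier inversion on the `2^t`-th
  roots of unity, indexed in binary);
* (T, NAMED FACT, `Literature/…/Bur24UnboundedDegreeTransfer.lean`) Bürgisser 2024 Thm. 4.10 (2):
  in characteristic zero, under GRH, `VP = VNP ⟹ VNPnb ⊆ VPnb` (`Bur24_thm_4_10_2`).

Consequences for the route `VPBoundarySquare` (`closes : EmptyBoundarySeparates →
CollapseEmptiesBoundary → VP ≠ VNP`; split `CollapseEmptiesBoundary ⟸ CollapseDebordersPresentable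
∧ PresentableCompletion`):

1. `collapseDebordersPresentable_of_ERH`: **GRH ∧ Thm 4.10(2) ⟹ `CollapseDebordersPresentable`**
   (the attacked child P_ε, item 23458, becomes a theorem modulo GRH and one named 2024 fact:
   `VP = VNP ⟹ \overline{VP}_ε ∩ p-fam ⊆ VNPnb ∩ p-fam ⊆ VPnb ∩ p-fam = VP`).
2. `valiant_of_ERH_of_Q_of_completion`: under the same two hypotheses the route's open content is
   `EmptyBoundarySeparates ∧ PresentableCompletion`.
3. `valiant_of_ERH_of_presentableWitness`: under GRH ∧ Thm 4.10(2), ONE explicit p-family in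
   `\overline{VP}_ε ∖ VP` proves `VP ≠ VNP` (the presentable boundary as a separating object).
4. The neutral statement `B_nb := VNPnbPFamSubsetVNP ℂ` ("p-bounded Boolean sums of p-size
   circuits of unbounded degree whose value is a p-family are p-definable"): `B_nb → U_ε`
   (`closureDefinablePres_of_booleanNbDefinable`), `U_ε^Σ → B_nb`, and the GRH dichotomy
   `GRH ∧ Thm 4.10(2) ⟹ ValiantsHypothesis ∨ B_nb` (`valiant_or_booleanNbDefinable_of_ERH`).

No statement of record changes; `closes` is untouched. 0 sorry.
-/

noncomputable section

set_option linter.dupNamespace false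

open MvPolynomial
open Literature.Computability.AlgebraicComplexity
open Literature.NumberTheory.LFunctions (ExtendedRiemannHypothesis)

namespace Summit.ValiantsHypothesis.ValiantsHypothesis.Theorems.VPBoundarySquareNbTransfer

open Summit.ValiantsHypothesis.ValiantsHypothesis.Theses.VPBoundarySquare
open Summit.ValiantsHypothesis.ValiantsHypothesis.Theorems.VPBoundarySquarePresentableSplit

/-- **RUNG (THEOREM) `\overline{VP}_ε ∩ p-fam ⊆ VNPnb^ℂ`** for families on `Fin (v n)`: every
p-family with p-bounded presentable border complexity is a p-bounded Boolean sum of p-size circuits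
(of exponential degree). [cite: BhargavDwivediSaxena2024, Lemma 4.1 (p. 13)] -/
theorem presentableInVNPnb (v : ℕ → ℕ) (f : ∀ n, MvPolynomial (Fin (v n)) ℂ) (hpf : IsPFamily f)
    (hf : IsPresVPBarFamily f) : IsVNPnbFamily f :=
  hf.isVNPnbFamily hpf

/-- **K1. GRH ∧ Bürgisser 2024 Thm 4.10(2) ⟹ `CollapseDebordersPresentable`** (item 23458, the
attacked child P_ε): under `VP = VNP` every p-family in the presentable closure of VP is
p-computable — `\overline{VP}_ε ⊆ VNPnb` (A), `VNPnb ⊆ VPnb` (T under the collapse), and a `VPnb`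
family IS a family of p-bounded complexity (`isVPnbFamily_iff_isPComputable`).
[cite: Burgisser2024Completeness, Thm. 4.10 (2)] [cite: BhargavDwivediSaxena2024, Lemma 4.1] -/
theorem collapseDebordersPresentable_of_ERH (hGRH : ExtendedRiemannHypothesis)
    (h410 : Bur24_thm_4_10_2 ℂ) : CollapseDebordersPresentable :=
  fun hEq v f hpf hf =>
    ((isVPnbFamily_iff_isPComputable f).1 (h410 hGRH hEq v f (hf.isVNPnbFamily hpf))).2

/-- **K1′.** Hence GRH ∧ Thm 4.10(2) ∧ `PresentableCompletion` ⟹ `CollapseEmptiesBoundary` (the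
parent P of record, item 23842). [cite: Burgisser2024Completeness, Thm. 4.10 (2)] -/
theorem collapseEmptiesBoundary_of_ERH_of_completion (hGRH : ExtendedRiemannHypothesis)
    (h410 : Bur24_thm_4_10_2 ℂ) (hC : PresentableCompletion) : CollapseEmptiesBoundary :=
  collapseEmptiesBoundaryOfPresentable_holds (collapseDebordersPresentable_of_ERH hGRH h410) hC

/-- **K2. Under GRH ∧ Thm 4.10(2) the route's open content is `EmptyBoundarySeparates ∧
PresentableCompletion`** (fed through the route's own `closes`). [cite: Burgisser2024Completeness, Thm. 4.10 (2)] -/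
theorem valiant_of_ERH_of_Q_of_completion (hGRH : ExtendedRiemannHypothesis)
    (h410 : Bur24_thm_4_10_2 ℂ) (hQ : EmptyBoundarySeparates) (hC : PresentableCompletion) :
    ValiantsHypothesis :=
  closes hQ (collapseEmptiesBoundary_of_ERH_of_completion hGRH h410 hC)

/-- **K3. The presentable boundary separates (under GRH ∧ Thm 4.10(2))**: one p-family on
`Fin (v n)` with p-bounded presentable border complexity that is NOT p-computable proves
`VP_ℂ ≠ VNP_ℂ`. [cite: Burgisser2024Completeness, Thm. 4.10 (2)] [cite: BhargavDwivediSaxena2024, §1.2 (p. 5)] -/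
theorem valiant_of_ERH_of_presentableWitness (hGRH : ExtendedRiemannHypothesis)
    (h410 : Bur24_thm_4_10_2 ℂ) {v : ℕ → ℕ} {f : ∀ n, MvPolynomial (Fin (v n)) ℂ}
    (hpf : IsPFamily f) (hf : IsPresVPBarFamily f) (hnc : ¬ IsPComputable f) :
    ValiantsHypothesis := by
  intro hEq
  exact hnc (collapseDebordersPresentable_of_ERH hGRH h410 hEq v f hpf hf)

/-- **K3′ (set form).** Under GRH ∧ Thm 4.10(2): if the presentable closure of VP is NOT VP on
p-families, then `VP ≠ VNP`. [cite: Burgisser2024Completeness, Thm. 4.10 (2)] -/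
theorem valiant_of_ERH_of_presentableBoundaryNonempty (hGRH : ExtendedRiemannHypothesis)
    (h410 : Bur24_thm_4_10_2 ℂ)
    (hM : ¬ ∀ (v : ℕ → ℕ) (f : ∀ n, MvPolynomial (Fin (v n)) ℂ),
      IsPFamily f → IsPresVPBarFamily f → IsPComputable f) :
    ValiantsHypothesis := by
  intro hEq
  exact hM fun v f hpf hf => collapseDebordersPresentable_of_ERH hGRH h410 hEq v f hpf hf

/-! ### The neutral statement `B_nb = VNPnbPFamSubsetVNP ℂ` and its arrows -/

/-- **`B_nb → U_ε`**: if Boolean sums of unbounded-degree p-size circuits with p-family values are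
p-definable, the presentable closure of VP is p-definable (`ClosureDefinablePres`, item 23449).
[cite: BhargavDwivediSaxena2024, Lemma 4.1 and §6 (p. 16)] -/
theorem closureDefinablePres_of_booleanNbDefinable (hB : VNPnbPFamSubsetVNP ℂ) :
    ClosureDefinablePres :=
  presVPBarSubsetVNP_of_vnpnbPFamSubsetVNP hB

/-- **`B_nb → P_ε`** (through `U_ε`). [cite: BhargavDwivediSaxena2024, Lemma 4.1] -/
theorem collapseDebordersPresentable_of_booleanNbDefinable (hB : VNPnbPFamSubsetVNP ℂ) :
    CollapseDebordersPresentable :=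
  collapseDebordersPresentable_of_closureDefinablePres (closureDefinablePres_of_booleanNbDefinable hB)

/-- **`U_ε^Σ → B_nb`**: `\overline{VNP}_ε ⊆ VNP` implies `B_nb` (every `VNPnb` family is presentably
p-definable with order `0`). [cite: BhargavDwivediSaxena2024, Thm. 1.3 and §6] -/
theorem booleanNbDefinable_of_presVNPBarSubsetVNP (h : PresVNPBarSubsetVNP ℂ) :
    VNPnbPFamSubsetVNP ℂ :=
  vnpnbPFamSubsetVNP_of_presVNPBarSubsetVNP h

/-- **GRH ∧ Thm 4.10(2) ∧ `VP = VNP` ⟹ `B_nb`**: under the collapse `VNPnb ∩ p-fam ⊆ VPnb ∩ p-fam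
= VP ⊆ VNP`. [cite: Burgisser2024Completeness, Thm. 4.10 (2)] -/
theorem booleanNbDefinable_of_ERH_of_collapse (hGRH : ExtendedRiemannHypothesis)
    (h410 : Bur24_thm_4_10_2 ℂ) (hEq : VP ℂ = VNP ℂ) : VNPnbPFamSubsetVNP ℂ :=
  fun v f hpf hf =>
    IsVPFamily.isVNPFamily_holds' ⟨hpf, ((isVPnbFamily_iff_isPComputable f).1 (h410 hGRH hEq v f hf)).2⟩

/-- **The GRH dichotomy**: under GRH ∧ Thm 4.10(2), either Valiant's hypothesis holds over `ℂ` or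
`B_nb` holds (and then `U_ε`, `P_ε` hold outright). [cite: Burgisser2024Completeness, Thm. 4.10 (2)] -/
theorem valiant_or_booleanNbDefinable_of_ERH (hGRH : ExtendedRiemannHypothesis)
    (h410 : Bur24_thm_4_10_2 ℂ) : ValiantsHypothesis ∨ VNPnbPFamSubsetVNP ℂ := by
  by_cases hEq : VP ℂ = VNP ℂ
  · exact Or.inr (booleanNbDefinable_of_ERH_of_collapse hGRH h410 hEq)
  · exact Or.inl hEq

end Summit.ValiantsHypothesis.ValiantsHypothesis.Theorems.VPBoundarySquareNbTransfer

end
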